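import Mathlib
import Summits.CriticalPhenomena.CardyFormulaZ2.Theorems.CardySelfRefinementTrivialSectorRateStubFourArmAboveOneSecondMoment
import Summits.CriticalPhenomena.CardyFormulaZ2.Theorems.CardySelfRefinementTrivialSectorRateStubSixArmDecayCentres
import Literature.Probability.Percolation.Z2HalfPlaneTwoArm
import HarnessLib

/-!
# Stub `stub_boundaryRelevance` of line `far-field-is-a-quarter-turn` (crux `TrivialSectorRate`,
stmt-CriticalPhenomena-10266): input (W1b) — the docked half-plane TWO-arm window bound for `M_k`
along an RSW path, at every vertical offset of the boundary line

Lawler–Schramm–Werner's Lemma A.1 in the window form of the tree's `Z2HalfPlane.real_twoArm_le`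
(`Literature/Probability/Percolation/Z2HalfPlaneTwoArm.lean`, Bernoulli percolation), for the dependent
law `M_k(γ s)` (`k = 2, 3`) read after the vertical translation by `t` (the boundary line may have any
residue mod `k`; `M_k` is only `kℤ²`-periodic), ASSUMING the recentred restricted tail bound `htail`
for the number `Z` of crossing clusters (input (W1a)).  Only the probabilistic part of the tree file
is redone, for the translated law `ν = M_k(γ s) ∘ (ω ↦ ω + (0,t))⁻¹`:
* `exists_ratio_real_preimage_boxCrossingEvent_le_half_along` — RSW at a fixed ratio for the
  TRANSLATED configuration, uniformly in the translation and in `s` (dual circuits in `J` separated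
  geometric annuli around `-c - (1,1)`: `circuitsAlong`, `real_biInter_compl_dualCircuitInAnnulusAt_eq_prod`,
  `not_mem_dualCircuitInAnnulusAt_of_openWalk`);
* `integral_numCrossingClusters_inter_le_one`, `sum_real_windows_le_one` — `E_ν[Z(ω ∩ E_ℍ)] ≤ 1` from
  the tail, and the window sums `≤ 1` through the deterministic counting
  `Z2HalfPlane.card_filter_twoArmLE_le` / `…GT…` (every `ν`-a.e. configuration is a lattice one);
* `real_twoArm_le_of_periodic` — the bound `ν(twoArm j m R) ≤ 12 N₀ m / n` for any probability law
  carried by lattice configurations, invariant under the HORIZONTAL translations of `kℤ`, with the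
  tail at ratio `K₀` above scale `N₀`: the windows of `[-n, n)` of width `w = k(m+1)` are congruent
  mod `k`, hence equiprobable, and `[j, j+m)` lies in a `kℤ`-translate of one of them;
* `twoArm_window_along_of_tail` (registered) — assembly (`M_real_preimage_relabel_shift_smul`).

References: Lawler–Schramm–Werner, Electron. J. Probab. 7 (2002), App. A, Lemma A.1; W. Werner,
*Lectures on two-dimensional critical percolation* (PCMI 2007), Lecture 2, first exercise sheet.

Target file:
`Summits/CriticalPhenomena/CardyFormulaZ2/Theorems/CardySelfRefinementTrivialSectorRateStubBoundaryRelevanceTwoArmWindow.lean`.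
-/

noncomputable section

namespace Summit.CriticalPhenomena.CardyFormulaZ2.Theorems.CardySelfRefinement.FarField

open Set MeasureTheory
open Literature.Probability.LatticeModels Literature.Probability.Percolation
open Literature.Probability.Percolation.QuadCrossing
open Summit.CriticalPhenomena.CardyFormulaZ2.Theses.CardySelfRefinement

/-! ### RSW at a fixed ratio for the translated configuration -/

/-- **A crossing of the recentred annulus meets every intermediate annulus.**  For radii
`N + 1 ≤ aᵢ`, `1 ≤ aᵢ ≤ bᵢ`, `bᵢ + 1 ≤ R`: if the configuration translated by `c` crosses
`B(R) ∖ B(N)`, then `ω` itself has an open lattice walk from `-c + B(N)` to `-c + ∂B(R)`, which is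
incompatible with a closed dual circuit of each dual annulus around `-c - (1,1)`
(`not_mem_dualCircuitInAnnulusAt_of_openWalk`; `M_k` is carried by lattice configurations). -/
theorem real_preimage_boxCrossingEvent_le_real_biInter (k : ℕ) (ρ c₀ : ℝ) (c : Site 2) {N R : ℕ}
    (hNR : N ≤ R) (s : Finset ℕ) (a b : ℕ → ℕ)
    (h : ∀ i ∈ s, 1 ≤ a i ∧ N + 1 ≤ a i ∧ a i ≤ b i ∧ b i + 1 ≤ R) :
    (M k ρ c₀).real (BondConfig.relabel (sym2Equiv (Site.shift c)) ⁻¹' boxCrossingEvent N R) ≤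
      (M k ρ c₀).real (⋂ i ∈ s, (dualCircuitInAnnulusAt (-c - 1) (a i) (b i))ᶜ) := by
  refine ENNReal.toReal_mono (measure_ne_top _ _) (measure_mono_ae ?_)
  have hae : ∀ᵐ ω ∂(M k ρ c₀), ω ⊆ (zdGraph 2).edgeSet :=
    selfRefinementMeasure_ae_subset_edgeSet k ρ c₀
  filter_upwards [hae] with ω hω hA
  obtain ⟨x, hx, y, hy, hr⟩ :=
    (hA : BondConfig.relabel (sym2Equiv (Site.shift c)) ω ∈ boxCrossingEvent N R)
  obtain ⟨p, -, hp⟩ := exists_walk_of_boxOpenGraph_reachable (relabel_shift_subset_edgeSet c hω)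
    (box_mono 2 hNR hx) hr
  have hp' := forall_edges_map_shift_mem_relabel (v := -c) p hp
  rw [relabel_shift_neg_relabel_shift] at hp'
  have hsh : ∀ z : Site 2, (zdShiftIso (-c)).toHom z - (-c - 1) - 1 = z := fun z => by
    show z + -c - (-c - 1) - 1 = z
    abel
  refine mem_iInter₂.2 fun i hi => ?_
  obtain ⟨h1, h2, h3, h4⟩ := h i hi
  refine not_mem_dualCircuitInAnnulusAt_of_openWalk h1 h3 hω _ hp' ?_ ?_
  · rw [hsh]; exact box_mono 2 (by omega) hx
  · rw [siteSphere, Finset.mem_sdiff] at hy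
    rw [hsh]; exact fun hy' => hy.2 (box_mono 2 (by omega) hy')

/-- **RSW at a fixed large ratio along the path, for the translated configuration**: for
`PathOK k γ`, `k = 2, 3`, there are `K₀ ≥ 2` and `N₀ ≥ 1` with
`M_k(γ s){ω | ω + c ∈ boxCrossingEvent N (K₀ N)} ≤ 1/2` for every `s`, every translation `c` and
every `N ≥ N₀` (dual circuits in `J` separated geometric annuli around `-c - (1,1)` by
`circuitsAlong` at aspect ratio `4`, independent by `real_biInter_compl_dualCircuitInAnnulusAt_eq_prod`,
`(1 - ρ₄)^J ≤ 1/2`, `K₀ = 4^{J+1}`; the proof of `exists_ratio_real_boxCrossingEvent_le_half_along`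
at a general centre). -/
theorem exists_ratio_real_preimage_boxCrossingEvent_le_half_along {k : ℕ} (hk : k = 2 ∨ k = 3)
    {γ : unitInterval → ℝ × ℝ} (hγ : PathOK k γ) :
    ∃ K₀ N₀ : ℕ, 2 ≤ K₀ ∧ 1 ≤ N₀ ∧ ∀ (s : unitInterval) (c : Site 2) (N : ℕ), N₀ ≤ N →
      (M k (γ s).1 (γ s).2).real
          (BondConfig.relabel (sym2Equiv (Site.shift c)) ⁻¹' boxCrossingEvent N (K₀ * N)) ≤ 1 / 2 := by
  have hk0 : 0 < k := by rcases hk with rfl | rfl <;> norm_num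
  have hk3 : k ≤ 3 := by rcases hk with rfl | rfl <;> norm_num
  obtain ⟨ρs, hρs, a₀, hcirc⟩ := circuitsAlong hk hγ (K := 4) (by norm_num)
  set q : ℝ := max (1 - ρs) 0 with hq
  have hq1 : q < 1 := max_lt (by linarith) (by norm_num)
  obtain ⟨J, hJ⟩ := exists_pow_lt_of_lt_one (by norm_num : (0 : ℝ) < 1 / 2) hq1
  refine ⟨4 ^ (J + 1), max a₀ 1, ?_, le_max_right _ _, fun s c N hN => ?_⟩
  · exact le_trans (by norm_num : 2 ≤ 4 ^ 1) (Nat.pow_le_pow_right (by norm_num) (by omega))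
  haveI := isProbabilityMeasure_M k (γ s).1 (γ s).2
  have hN1 : 1 ≤ N := (le_max_right _ _).trans hN
  have hNa : a₀ ≤ N + 1 := ((le_max_left _ _).trans hN).trans (Nat.le_succ _)
  have hNR : N ≤ 4 ^ (J + 1) * N := Nat.le_mul_of_pos_left N (by positivity)
  have hpow : ∀ i : ℕ, N + 1 ≤ 4 ^ i * (N + 1) := fun i =>
    Nat.le_mul_of_pos_left (N + 1) (Nat.one_le_pow _ _ (by norm_num))
  have hJR : ∀ i < J, 2 * (4 ^ i * (N + 1)) + 1 ≤ 4 ^ (J + 1) * N := by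
    intro i hi
    have h1 : 4 ^ (i + 1) ≤ 4 ^ J := Nat.pow_le_pow_right (by norm_num) hi
    have h3 : 4 ^ (i + 1) = 4 * 4 ^ i := by ring
    have h4 : 4 ^ (J + 1) = 4 * 4 ^ J := by ring
    have hP : 1 ≤ 4 ^ i := Nat.one_le_pow _ _ (by norm_num)
    rw [h3] at h1; rw [h4]; nlinarith
  have hgeom : ∀ i ∈ Finset.range J, 1 ≤ 4 ^ i * (N + 1) ∧ N + 1 ≤ 4 ^ i * (N + 1) ∧
      4 ^ i * (N + 1) ≤ 2 * (4 ^ i * (N + 1)) ∧ 2 * (4 ^ i * (N + 1)) + 1 ≤ 4 ^ (J + 1) * N := by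
    intro i hi
    have h2 := hpow i
    have h3 := hJR i (Finset.mem_range.1 hi)
    omega
  have hfar : ∀ i ∈ Finset.range J, ∀ j ∈ Finset.range J, i < j →
      2 * (4 ^ i * (N + 1)) + k ≤ 4 ^ j * (N + 1) := by
    intro i _ j _ hij
    have h1 : 4 ^ (i + 1) ≤ 4 ^ j := Nat.pow_le_pow_right (by norm_num) hij
    have h2 : 4 ^ (i + 1) * (N + 1) ≤ 4 ^ j * (N + 1) := Nat.mul_le_mul_right (N + 1) h1
    have h3 : 4 ^ (i + 1) * (N + 1) = 4 * (4 ^ i * (N + 1)) := by ring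
    have h4 := hpow i
    omega
  have hqi : ∀ i ∈ Finset.range J, 1 - (M k (γ s).1 (γ s).2).real
      (dualCircuitInAnnulusAt (-c - 1) (4 ^ i * (N + 1)) (2 * (4 ^ i * (N + 1)))) ≤ q := by
    intro i _
    have h4 := hpow i
    have := (hcirc s (-c - 1) (4 ^ i * (N + 1)) (2 * (4 ^ i * (N + 1))) (by omega) (by omega)
      (by omega)).2
    have := le_max_left (1 - ρs) (0 : ℝ)
    linarith
  refine le_trans ?_ hJ.le
  calc (M k (γ s).1 (γ s).2).real
        (BondConfig.relabel (sym2Equiv (Site.shift c)) ⁻¹' boxCrossingEvent N (4 ^ (J + 1) * N))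
      ≤ (M k (γ s).1 (γ s).2).real (⋂ i ∈ Finset.range J,
          (dualCircuitInAnnulusAt (-c - 1) (4 ^ i * (N + 1)) (2 * (4 ^ i * (N + 1))))ᶜ) :=
        real_preimage_boxCrossingEvent_le_real_biInter k _ _ c hNR (Finset.range J)
          (fun i => 4 ^ i * (N + 1)) (fun i => 2 * (4 ^ i * (N + 1))) hgeom
    _ = ∏ i ∈ Finset.range J, (1 - (M k (γ s).1 (γ s).2).real
          (dualCircuitInAnnulusAt (-c - 1) (4 ^ i * (N + 1)) (2 * (4 ^ i * (N + 1))))) :=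
        real_biInter_compl_dualCircuitInAnnulusAt_eq_prod hk0 _ _ (-c - 1) (Finset.range J)
          (fun i => 4 ^ i * (N + 1)) (fun i => 2 * (4 ^ i * (N + 1))) hfar
    _ ≤ ∏ _i ∈ Finset.range J, q :=
        Finset.prod_le_prod (fun i _ => sub_nonneg.2 measureReal_le_one) hqi
    _ = q ^ J := by rw [Finset.prod_const, Finset.card_range]

/-! ### `E[Z] ≤ 1` and the window sums for a law with an exponential tail of `Z` -/

/-- **Tail to expectation**: if `ν(Z(ω ∩ E) ≥ i) ≤ 2^{-i}` for all `i`, then `E_ν[Z(ω ∩ E)] ≤ 1`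
(`Z = Σ_{i<|B(N)|} 𝟙[Z ≥ i+1]` and `Σ 2^{-(i+1)} ≤ 1`). -/
theorem integral_numCrossingClusters_inter_le_one (ν : Measure (BondConfig (Site 2)))
    [IsProbabilityMeasure ν] (E : Set (Sym2 (Site 2))) (N R : ℕ)
    (htail : ∀ i : ℕ, ν.real {ω | i ≤ numCrossingClusters (ω ∩ E) N R} ≤ (1 / 2) ^ i) :
    ∫ ω, (numCrossingClusters (ω ∩ E) N R : ℝ) ∂ν ≤ 1 := by
  set K : ℕ := (box 2 N).card with hK
  have hpt : ∀ ω, (numCrossingClusters (ω ∩ E) N R : ℝ) =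
      ∑ i ∈ Finset.range K, {ω | i + 1 ≤ numCrossingClusters (ω ∩ E) N R}.indicator
        (fun _ => (1 : ℝ)) ω := by
    intro ω
    rw [← Z2HalfPlane.sum_range_ite_succ_le (numCrossingClusters_le_card (ω ∩ E) N R)]
    refine Finset.sum_congr rfl fun i _ => ?_
    simp only [Set.indicator_apply, Set.mem_setOf_eq]
  simp_rw [hpt]
  have hmeas : ∀ i, MeasurableSet {ω | i + 1 ≤ numCrossingClusters (ω ∩ E) N R} := fun i =>
    Z2HalfPlane.measurableSet_setOf_numCrossingClusters_inter E N R (i + 1 ≤ ·)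
  rw [integral_finsetSum _ fun i _ => (integrable_const _).indicator (hmeas i)]
  calc ∑ i ∈ Finset.range K, ∫ ω, {ω | i + 1 ≤ numCrossingClusters (ω ∩ E) N R}.indicator
          (fun _ => (1 : ℝ)) ω ∂ν
      = ∑ i ∈ Finset.range K, ν.real {ω | i + 1 ≤ numCrossingClusters (ω ∩ E) N R} := by
        refine Finset.sum_congr rfl fun i _ => ?_
        rw [integral_indicator_const _ (hmeas i), smul_eq_mul, mul_one]
    _ ≤ ∑ i ∈ Finset.range K, ((1 : ℝ) / 2) ^ (i + 1) :=
        Finset.sum_le_sum fun i _ => htail (i + 1)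
    _ ≤ 1 := Z2HalfPlane.sum_range_half_pow_succ_le K

open Classical in
/-- **Window sums**: for a probability law `ν` carried by lattice configurations with
`E_ν[Z(ω ∩ E_ℍ; n, M)] ≤ 1`, and measurable events `F i` of which at most `Z(ω ∩ E_ℍ; n, M)` occur
among `i < L` at every lattice configuration (the deterministic counting
`Z2HalfPlane.card_filter_twoArmLE_le` / `…GT…`), `Σ_{i<L} ν(F i) ≤ 1`. -/
theorem sum_real_windows_le_one (ν : Measure (BondConfig (Site 2))) [IsProbabilityMeasure ν]
    (hae : ∀ᵐ ω ∂ν, ω ⊆ (zdGraph 2).edgeSet) {n M : ℕ}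
    (hZ : ∫ ω, (numCrossingClusters (ω ∩ Z2HalfPlane.hpEdges) n M : ℝ) ∂ν ≤ 1) {L : ℕ}
    (F : ℕ → Set (BondConfig (Site 2))) (hF : ∀ i, MeasurableSet (F i))
    (hcard : ∀ ω : BondConfig (Site 2), ω ⊆ (zdGraph 2).edgeSet →
      ((Finset.range L).filter fun i => ω ∈ F i).card ≤
        numCrossingClusters (ω ∩ Z2HalfPlane.hpEdges) n M) :
    ∑ i ∈ Finset.range L, ν.real (F i) ≤ 1 := by
  have hpt : ∀ᵐ ω ∂ν, ∑ i ∈ Finset.range L, (F i).indicator (fun _ => (1 : ℝ)) ω ≤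
      (numCrossingClusters (ω ∩ Z2HalfPlane.hpEdges) n M : ℝ) := by
    filter_upwards [hae] with ω hω
    have hsum : ∑ i ∈ Finset.range L, (F i).indicator (fun _ => (1 : ℝ)) ω =
        (((Finset.range L).filter fun i => ω ∈ F i).card : ℝ) := by
      rw [Finset.card_filter, Nat.cast_sum]
      refine Finset.sum_congr rfl fun i _ => ?_
      by_cases h : ω ∈ F i
      · rw [Set.indicator_of_mem h, if_pos h, Nat.cast_one]
      · rw [Set.indicator_of_notMem h, if_neg h, Nat.cast_zero]
    rw [hsum]
    exact_mod_cast hcard ω hω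
  have hint : ∀ i ∈ Finset.range L, Integrable (fun ω => (F i).indicator (fun _ => (1 : ℝ)) ω) ν :=
    fun i _ => (integrable_const _).indicator (hF i)
  have hZint : Integrable (fun ω => (numCrossingClusters (ω ∩ Z2HalfPlane.hpEdges) n M : ℝ)) ν := by
    refine Integrable.of_bound (C := ((box 2 n).card : ℝ)) ?_ (ae_of_all _ fun ω => ?_)
    · have hZm : Measurable fun ω : BondConfig (Site 2) =>
          numCrossingClusters (ω ∩ Z2HalfPlane.hpEdges) n M :=
        measurable_to_countable' fun i =>
          Z2HalfPlane.measurableSet_setOf_numCrossingClusters_inter Z2HalfPlane.hpEdges n M (· = i)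
      exact ((measurable_from_nat (f := (Nat.cast : ℕ → ℝ))).comp hZm).aestronglyMeasurable
    · rw [Real.norm_eq_abs, abs_of_nonneg (Nat.cast_nonneg _)]
      exact_mod_cast numCrossingClusters_le_card (ω ∩ Z2HalfPlane.hpEdges) n M
  calc ∑ i ∈ Finset.range L, ν.real (F i)
      = ∑ i ∈ Finset.range L, ∫ ω, (F i).indicator (fun _ => (1 : ℝ)) ω ∂ν := by
        refine Finset.sum_congr rfl fun i _ => ?_
        rw [integral_indicator_const _ (hF i), smul_eq_mul, mul_one]
    _ = ∫ ω, ∑ i ∈ Finset.range L, (F i).indicator (fun _ => (1 : ℝ)) ω ∂ν :=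
        (integral_finsetSum _ hint).symm
    _ ≤ ∫ ω, (numCrossingClusters (ω ∩ Z2HalfPlane.hpEdges) n M : ℝ) ∂ν :=
        integral_mono_ae (integrable_finsetSum _ hint) hZint hpt
    _ ≤ 1 := hZ

/-! ### The window bound for a horizontally `kℤ`-periodic law -/

/-- **The two-arm window bound for a periodic law with a tail** (Werner's counting): let `ν` be a
probability law on bond configurations of `ℤ²` carried by lattice configurations, invariant under
the horizontal translations by `kℤ` (`k > 0`), and such that above scale `N₀` the number `Z` of
clusters of `ω ∩ E_ℍ` crossing `B(K₀ n) ∖ B(n)` has the tail `ν(Z ≥ i) ≤ 2^{-i}`.  Then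
`ν(twoArm j m R) ≤ 12 N₀ m / n` whenever `1 ≤ m ≤ n` and `(K₀ + 2) n ≤ R`: the `⌊2n/w⌋` windows of
`[-n, n)` of width `w = k(m+1)` are congruent mod `k`, hence equiprobable, their probabilities sum
to `≤ E[Z] ≤ 1` (`sum_real_windows_le_one`), and `[j, j+m)` lies in a translate by `kℤ` of one of
them (monotonicity of `twoArm` in the window). -/
theorem real_twoArm_le_of_periodic {k : ℕ} (hk0 : 0 < k) (hk3 : k ≤ 3)
    (ν : Measure (BondConfig (Site 2))) [IsProbabilityMeasure ν] (hae : ∀ᵐ ω ∂ν, ω ⊆ (zdGraph 2).edgeSet)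
    (hinv : ∀ (a : ℤ) (A : Set (BondConfig (Site 2))),
      ν.real (BondConfig.relabel (sym2Equiv (Site.shift (Z2HalfPlane.hvec ((k : ℤ) * a)))) ⁻¹' A) =
        ν.real A)
    {K₀ N₀ : ℕ} (hK₀ : 1 ≤ K₀) (hN₀ : 1 ≤ N₀)
    (htail : ∀ n : ℕ, N₀ ≤ n → ∀ i : ℕ,
      ν.real {ω | i ≤ numCrossingClusters (ω ∩ Z2HalfPlane.hpEdges) n (K₀ * n)} ≤ (1 / 2) ^ i)
    (j : ℤ) {m n R : ℕ} (hm : 1 ≤ m) (hmn : m ≤ n) (hR : (K₀ + 2) * n ≤ R) :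
    ν.real (Z2HalfPlane.twoArm j m R) ≤ 12 * N₀ * m / n := by
  have hn : 1 ≤ n := le_trans hm hmn
  have hn0 : (0 : ℝ) < n := by exact_mod_cast hn
  have hm0 : (0 : ℝ) < m := by exact_mod_cast hm
  rcases le_or_gt n (12 * N₀ * m) with hsmall | hbig
  · calc ν.real (Z2HalfPlane.twoArm j m R) ≤ 1 := measureReal_le_one
      _ ≤ 12 * N₀ * m / n := by
          rw [le_div_iff₀ hn0, one_mul]; exact_mod_cast hsmall
  -- scales: the width `w = k (m + 1)` and the number `L = ⌊2n/w⌋ ≥ 1` of windows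
  have hnN : N₀ ≤ n := by nlinarith [Nat.mul_le_mul_left N₀ hm]
  obtain ⟨w, hw⟩ : ∃ w : ℕ, w = k * (m + 1) := ⟨_, rfl⟩
  have hk3w : m + k ≤ w := by rw [hw]; nlinarith [Nat.mul_le_mul_right m hk0]
  have hw6 : w ≤ 6 * m := by rw [hw]; nlinarith [Nat.mul_le_mul_right (m + 1) hk3]
  have hw2n : w ≤ 2 * n := by nlinarith [Nat.mul_le_mul_left m hN₀]
  have hw1 : 1 ≤ w := by omega
  obtain ⟨L, hL⟩ : ∃ L : ℕ, L = 2 * n / w := ⟨_, rfl⟩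
  have hL1 : 1 ≤ L := by rw [hL, Nat.le_div_iff_mul_le (by omega)]; omega
  have h2n : 2 * n < (L + 1) * w := by
    rw [hL]; exact Nat.lt_mul_of_div_lt (Nat.lt_succ_self _) (by omega)
  -- `E[Z] ≤ 1` at scale `n`, and the window sums
  have hM1 : 1 ≤ K₀ * n := le_trans hn (Nat.le_mul_of_pos_left n hK₀)
  have hnM : n ≤ K₀ * n := Nat.le_mul_of_pos_left n hK₀
  have hR' : K₀ * n + n + 1 ≤ R := by
    have : (K₀ + 2) * n = K₀ * n + n + n := by ring
    omega
  have hZ := integral_numCrossingClusters_inter_le_one ν Z2HalfPlane.hpEdges n (K₀ * n) (htail n hnN)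
  have hLE := sum_real_windows_le_one ν hae hZ
    (fun i => Z2HalfPlane.twoArmLE (Z2HalfPlane.winStart n w i) w R)
    (fun i => Z2HalfPlane.measurableSet_twoArmLE _ w R)
    (fun ω hω => Z2HalfPlane.card_filter_twoArmLE_le hω hw1 hM1 hnM hR')
  have hGT := sum_real_windows_le_one ν hae hZ
    (fun i => Z2HalfPlane.twoArmGT (Z2HalfPlane.winStart n w i) w R)
    (fun i => Z2HalfPlane.measurableSet_twoArmGT _ w R)
    (fun ω hω => Z2HalfPlane.card_filter_twoArmGT_le hω hw1 hM1 hnM hR')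
  rw [← hL] at hLE hGT
  -- the window of width `w` with left end `j - r ≡ -n (mod k)` containing `[j, j+m)`
  have hkz : (0 : ℤ) < k := by exact_mod_cast hk0
  obtain ⟨r, hr⟩ : ∃ r : ℤ, r = (j + n) % (k : ℤ) := ⟨_, rfl⟩
  obtain ⟨d, hd⟩ : ∃ d : ℤ, d = (j + n) / (k : ℤ) := ⟨_, rfl⟩
  have hrd : r + k * d = j + n := by rw [hr, hd]; exact Int.emod_add_mul_ediv _ _
  have hr0 : 0 ≤ r := by rw [hr]; exact Int.emod_nonneg _ hkz.ne'
  have hrk : r < k := by rw [hr]; exact Int.emod_lt_of_pos _ hkz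
  have hwin : ∀ i : ℕ, Z2HalfPlane.winStart n w i = (j - r) + (k : ℤ) * (i * (m + 1) - d) := by
    intro i
    unfold Z2HalfPlane.winStart; rw [hw]; push_cast; linear_combination hrd
  have heqLE : ∀ i ∈ Finset.range L, ν.real (Z2HalfPlane.twoArmLE (Z2HalfPlane.winStart n w i) w R) =
      ν.real (Z2HalfPlane.twoArmLE (j - r) w R) := by
    intro i _
    rw [hwin i, ← Z2HalfPlane.preimage_relabel_shift_twoArmLE (j - r) ((k : ℤ) * _) w R, hinv]
  have heqGT : ∀ i ∈ Finset.range L, ν.real (Z2HalfPlane.twoArmGT (Z2HalfPlane.winStart n w i) w R) =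
      ν.real (Z2HalfPlane.twoArmGT (j - r) w R) := by
    intro i _
    rw [hwin i, ← Z2HalfPlane.preimage_relabel_shift_twoArmGT (j - r) ((k : ℤ) * _) w R, hinv]
  rw [Finset.sum_congr rfl heqLE, Finset.sum_const, Finset.card_range, nsmul_eq_mul] at hLE
  rw [Finset.sum_congr rfl heqGT, Finset.sum_const, Finset.card_range, nsmul_eq_mul] at hGT
  have hsub : Z2HalfPlane.twoArm j m R ⊆
      Z2HalfPlane.twoArmLE (j - r) w R ∪ Z2HalfPlane.twoArmGT (j - r) w R := by
    refine Subset.trans (fun ω ⟨a, b, hja, ham, hjb, hbm, hrest⟩ => ?_) (Z2HalfPlane.twoArm_subset_union _ w R)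
    exact ⟨a, b, by omega, by omega, by omega, by omega, hrest⟩
  have hun : ν.real (Z2HalfPlane.twoArm j m R) ≤
      ν.real (Z2HalfPlane.twoArmLE (j - r) w R) + ν.real (Z2HalfPlane.twoArmGT (j - r) w R) :=
    (measureReal_mono hsub (measure_ne_top _ _)).trans (measureReal_union_le _ _)
  have hx : (L : ℝ) * ν.real (Z2HalfPlane.twoArm j m R) ≤ 2 := by
    nlinarith [mul_le_mul_of_nonneg_left hun (Nat.cast_nonneg L : (0 : ℝ) ≤ L)]
  have hn6 : (n : ℝ) ≤ 6 * L * m := by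
    have e1 : (2 * n : ℝ) < (L + 1) * w := by exact_mod_cast h2n
    have e2 : (w : ℝ) ≤ 6 * m := by exact_mod_cast hw6
    have e3 : (1 : ℝ) ≤ L := by exact_mod_cast hL1
    nlinarith [mul_le_mul_of_nonneg_left e2 (by positivity : (0 : ℝ) ≤ L + 1),
      mul_nonneg (sub_nonneg.2 e3) hm0.le]
  rw [le_div_iff₀ hn0]
  calc ν.real (Z2HalfPlane.twoArm j m R) * n
      ≤ ν.real (Z2HalfPlane.twoArm j m R) * (6 * L * m) :=
        mul_le_mul_of_nonneg_left hn6 measureReal_nonneg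
    _ = 6 * m * ((L : ℝ) * ν.real (Z2HalfPlane.twoArm j m R)) := by ring
    _ ≤ 6 * m * 2 := mul_le_mul_of_nonneg_left hx (by positivity)
    _ ≤ 12 * N₀ * m := by
        have e : (1 : ℝ) ≤ N₀ := by exact_mod_cast hN₀
        nlinarith [mul_nonneg (sub_nonneg.2 e) hm0.le]

/-! ### Assembly for `M_k(γ s)` translated by `(0, t)` -/

/-- Probabilities of the translated law are probabilities of preimages (all sets: the translation
is a measurable equivalence). -/
theorem real_map_relabel_shift (μ : Measure (BondConfig (Site 2))) (c : Site 2)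
    (A : Set (BondConfig (Site 2))) :
    (μ.map (BondConfig.relabel (sym2Equiv (Site.shift c)))).real A =
      μ.real (BondConfig.relabel (sym2Equiv (Site.shift c)) ⁻¹' A) := by
  rw [measureReal_def, measureReal_def, MeasurableEquiv.map_apply]

/-- The horizontal translation vector `(k a, 0)` is `k • (a, 0)`. -/
theorem hvec_mul_eq_smul (k a : ℤ) : Z2HalfPlane.hvec (k * a) = k • (![a, 0] : Site 2) := by
  ext i
  fin_cases i <;> simp [Z2HalfPlane.hvec]

/-- **(W1b) The docked half-plane two-arm window bound for `M_k` along the path, at every vertical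
offset of the boundary line** (the configuration is read after the vertical translation by `t`),
from the tail bound of (W1a): there are `C > 0` and `K ≥ 1` with
`M_k(γ s){ω | ω + (0,t) ∈ twoArm j m R} ≤ C m / n` for all `s`, `t`, `j` and all `1 ≤ m ≤ n`,
`K n ≤ R` (Lawler–Schramm–Werner's Lemma A.1, window form, exponent exactly `1`). -/
theorem twoArm_window_along_of_tail {k : ℕ} (hk : k = 2 ∨ k = 3) {γ : unitInterval → ℝ × ℝ}
    (hγ : PathOK k γ)
    (htail : ∀ (q : ℝ × ℝ) (c : Site 2) (E : Set (Sym2 (Site 2))) (N R n : ℕ),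
      (M k q.1 q.2).real {ω | n ≤ numCrossingClusters
          (BondConfig.relabel (sym2Equiv (Site.shift c)) ω ∩ E) N R} ≤
        ((M k q.1 q.2).real {ω | BondConfig.relabel (sym2Equiv (Site.shift c)) ω ∩ E ∈
          boxCrossingEvent N R}) ^ n) :
    ∃ C : ℝ, 0 < C ∧ ∃ K : ℕ, 1 ≤ K ∧ ∀ (s : unitInterval) (t j : ℤ) (m n R : ℕ),
      1 ≤ m → m ≤ n → K * n ≤ R →
        (M k (γ s).1 (γ s).2).real
          (BondConfig.relabel (sym2Equiv (Site.shift (![0, t] : Site 2))) ⁻¹' Z2HalfPlane.twoArm j m R) ≤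
          C * m / n := by
  have hk0 : 0 < k := by rcases hk with rfl | rfl <;> norm_num
  have hk3 : k ≤ 3 := by rcases hk with rfl | rfl <;> norm_num
  obtain ⟨K₀, N₀, hK₀, hN₀, hA⟩ := exists_ratio_real_preimage_boxCrossingEvent_le_half_along hk hγ
  have hN₀' : (0 : ℝ) < N₀ := by exact_mod_cast hN₀
  refine ⟨12 * N₀, by positivity, K₀ + 2, by omega, fun s t j m n R hm hmn hR => ?_⟩
  set μ := M k (γ s).1 (γ s).2 with hμ
  haveI : IsProbabilityMeasure μ := isProbabilityMeasure_M k _ _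
  set T := BondConfig.relabel (sym2Equiv (Site.shift (![0, t] : Site 2))) with hT
  haveI : IsProbabilityMeasure (μ.map T) := Measure.isProbabilityMeasure_map T.measurable.aemeasurable
  -- the translated law is carried by lattice configurations
  have hae : ∀ᵐ ω ∂(μ.map T), ω ⊆ (zdGraph 2).edgeSet := by
    refine T.measurableEmbedding.ae_map_iff.2 ?_
    filter_upwards [selfRefinementMeasure_ae_subset_edgeSet k (γ s).1 (γ s).2] with ω hω
    exact relabel_shift_subset_edgeSet _ hω
  -- it is invariant under the horizontal translations of `kℤ` (they commute with `T`)
  have hinv : ∀ (a : ℤ) (A : Set (BondConfig (Site 2))),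
      (μ.map T).real
          (BondConfig.relabel (sym2Equiv (Site.shift (Z2HalfPlane.hvec ((k : ℤ) * a)))) ⁻¹' A) =
        (μ.map T).real A := by
    intro a A
    rw [hT, real_map_relabel_shift, real_map_relabel_shift,
      ← M_real_preimage_relabel_shift_smul hk0.ne' (γ s).1 (γ s).2 (![a, 0] : Site 2)
        (BondConfig.relabel (sym2Equiv (Site.shift (![0, t] : Site 2))) ⁻¹' A)]
    congr 1
    ext ω
    simp only [mem_preimage]
    rw [relabel_shift_relabel_shift, relabel_shift_relabel_shift, hvec_mul_eq_smul, add_comm]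
  -- the tail of `Z` for the translated law, from `htail` and RSW at ratio `K₀`
  have htail' : ∀ N : ℕ, N₀ ≤ N → ∀ i : ℕ,
      (μ.map T).real {ω | i ≤ numCrossingClusters (ω ∩ Z2HalfPlane.hpEdges) N (K₀ * N)} ≤
        (1 / 2) ^ i := by
    intro N hN i
    rw [hT, real_map_relabel_shift, preimage_setOf_eq]
    refine (htail (γ s) _ _ N (K₀ * N) i).trans (pow_le_pow_left₀ measureReal_nonneg ?_ i)
    refine (measureReal_mono (fun ω hω => ?_) (measure_ne_top _ _)).trans (hA s (![0, t]) N hN)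
    exact isUpperSet_boxCrossingEvent N (K₀ * N) inter_subset_left hω
  have key := real_twoArm_le_of_periodic hk0 hk3 (μ.map T) hae hinv (by omega) hN₀ htail' j hm hmn hR
  rwa [hT, real_map_relabel_shift] at key

end Summit.CriticalPhenomena.CardyFormulaZ2.Theorems.CardySelfRefinement.FarField

end
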